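import Summits.CriticalPhenomena.PercolationContinuityZ3.Theses.PercLowPointHalfSpace
import Summits.CriticalPhenomena.PercolationContinuityZ3.Theses.PercAnnulusCrossing
import Summits.CriticalPhenomena.PercolationContinuityZ3.Theorems.QuantitativeBGN.Negative.LoadBearing
import HarnessLib

/-!
# `QuantitativeBGN` is dominated by the annulus-crossing crux `X_B` (dyadic peeling)

Helper file (`--supports stmt-CriticalPhenomena-0913`) for the crux
`Summit.CriticalPhenomena.PercolationContinuityZ3.Theses.PercLowPointHalfSpace.QuantitativeBGN`
(quantitative Barsky–Grimmett–Newman: `P_{p_c(ℤ³)}(arm_H(0,r)) ≤ C r^{-a}` for some `a > 0`),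
recording its position in the summit's dependency graph: it is IMPLIED by the items of route
`PercAnnulusCrossing`.

* `critCrossingPolyDecay_of_critAnnulusNonCrossing` :
  `CritAnnulusNonCrossing → CritCrossingPolyDecay` (items stmt-0846 → stmt-0849 of
  `PercAnnulusCrossing`). If `P_{p_c}(B(n') ↔ ∂B(2n') in B(2n')) ≤ 1 - c` for all `n' ≥ 1`, then
  `P_{p_c}(B(n) ↔ ∂B(m) in B(m)) ≤ C (n/m)^a` for `1 ≤ n ≤ m`, with `a = -log₂(1 - min(c,1/2))`,
  `C = 6^a`. Proof ("dyadic peeling"; Newman–Tassion–Wu 2017 §3.8 on slabs, Grimmett 1999 §11.7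
  in `d = 2`): an open path inside `B(2m+2)` from `B(n)` to `∂B(2m+2)` contains an initial segment
  inside `B(m)` from `B(n)` to `∂B(m)` (first exit) and a final segment inside the annulus
  `B(2m+2) ∖ B(m)` from `B(m+1)` to `∂B(2m+2)` (last visit to `B(m)`), so
  `Cross(n, 2m+2) ⊆ Cross(n, m) ∩ Ann(m)`; the two events are determined by the disjoint pair sets
  `B(m).sym2` and `(B(2m+2) ∖ B(m)).sym2`, hence independent
  (`DCT16.real_inter_of_determinedBy_disjoint`), and `Ann(m) ⊆ {B(m+1) ↔ ∂B(2(m+1)) in B(2(m+1))}`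
  has probability `≤ 1 - c`. Thus `P(Cross(n, 2m+2)) ≤ (1-c) P(Cross(n, m))`; `k`-fold iteration
  along `m ↦ 2m+2` gives `P(Cross(n,m)) ≤ (1-c)^k` whenever `(n+2) 2^k ≤ m+2`, and the choice
  `k = ⌊log₂((m+2)/(n+2))⌋` with `2^{k+1} > (m+2)/(n+2)` turns this into `6^a (n/m)^a`.
* `quantitativeBGN_of_critCrossingPolyDecay` (registered sub-goal) :
  `CritCrossingPolyDecay → QuantitativeBGN`, since `arm_H(0,r) ⊆ {0 ↔ ∂Λ_{r-1} in Λ_{r-1}} ⊆ Cross(1, r-1)`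
  (first exit; `Negative.mem_siteToBoundary_of_mem_armH`), and `(1/(r-1))^a ≤ 2^a r^{-a}` for `r ≥ 2`.

The composite edge `CritAnnulusNonCrossing → QuantitativeBGN` is already in the tree
(`quantitativeBGN_of_critAnnulusNonCrossing`, `…QuantitativeBGNConeEdges.lean`, lead c6, via the bulk
one-arm dictionary of route `PercNonProliferation`); the present file supplies the two finer edges
through the set-to-boundary item `CritCrossingPolyDecay` (its two-parameter form `C (n/m)^a` does not
follow from a point one-arm rate, whence the peeling here), and the weakest same-`p` half-space input
is typed in `…QuantitativeBGNHalfSpaceBlocking.lean` (lead c6). Bookkeeping consequence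
(`Cruxes/QuantitativeBGN/PICKED.md`, lead a1): any input strong enough for the bulk box-crossing
statement `X_B = CritAnnulusNonCrossing` settles this crux; a dedicated line for `QuantitativeBGN` must
use the floor `{x₀ = 0}` in a way unavailable to `X_B`.

Events (written out in full at every occurrence; the file introduces no definitions):
`Cross(n, m) = {ω | ∃ x ∈ B(n), ∃ y ∈ ∂B(m), x ↔ y in B(m)}` (the event of `CritAnnulusNonCrossing`,
`m = 2n`, and of `CritCrossingPolyDecay`), and the annulus crossing
`Ann(m) = {ω | ∃ x ∈ B(m+1), ∃ y ∈ ∂B(2(m+1)), x ↔ y in B(2(m+1)) ∖ B(m)}`.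

Sources: G. Grimmett, *Percolation* (1999), §11.7 (dyadic annuli, `d = 2`); C. M. Newman,
V. Tassion, W. Wu, *Critical percolation and the minimal spanning tree in slabs*, CPAM 70 (2017),
Cor. 3.2(3), §3.8.
-/

noncomputable section

namespace Summit.CriticalPhenomena.PercolationContinuityZ3.Theorems

open MeasureTheory Literature.Probability.Percolation Literature.Probability.LatticeModels
open Summit.CriticalPhenomena.PercolationContinuityZ3.Theses

namespace OfAnnulusCrossing

/-! ## Path surgery -/

/-- **First exit.** An open path (inside any set) from `x ∈ B(n) ∩ B(m')` to a site outside `B(m')`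
contains an initial segment inside `B(m')` from `x` to `∂B(m')`; hence `ω ∈ Cross(n, m')`
(for `ω ⊆ E(ℤ³)`). [folklore] -/
theorem mem_cross_of_pathIn {ω : BondConfig (Site 3)} (hω : ω ⊆ (zdGraph 3).edgeSet)
    {A : Set (Site 3)} {x z : Site 3} {n m' : ℕ} (hx : x ∈ box 3 n) (hxm : x ∈ box 3 m')
    (hz : z ∉ box 3 m') (hp : PathIn (openGraph ω) A x z) :
    ω ∈ {ω : BondConfig (Site 3) | ∃ x ∈ box 3 n, ∃ y ∈ innerBoundary (zdGraph 3) (box 3 m'),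
      ω ∈ openConnIn (↑(box 3 m') : Set (Site 3)) x y} := by
  obtain ⟨a, b, ha, hb, -, hab, hpa⟩ :=
    hp.exit (R := (↑(box 3 m') : Set (Site 3))) (Finset.mem_coe.2 hxm)
      (fun h => hz (Finset.mem_coe.1 h))
  refine ⟨x, hx, a, ?_, DCT16.mem_openConnIn_of_pathIn (hpa.mono Set.inter_subset_left)⟩
  exact mem_innerBoundary_iff.2 ⟨Finset.mem_coe.1 ha, b, fun h => hb (Finset.mem_coe.2 h),
    DCT16.adj_of_openGraph_adj hω hab⟩

/-- **`Cross(n, ·)` is non-increasing**: for `n ≤ m' ≤ m`, `Cross(n, m) ⊆ Cross(n, m')` on lattice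
configurations (first exit from `B(m')`). [folklore] -/
theorem mem_cross_anti {ω : BondConfig (Site 3)} (hω : ω ⊆ (zdGraph 3).edgeSet) {n m' m : ℕ}
    (hnm' : n ≤ m') (hm'm : m' ≤ m)
    (h : ω ∈ {ω : BondConfig (Site 3) | ∃ x ∈ box 3 n, ∃ y ∈ innerBoundary (zdGraph 3) (box 3 m),
      ω ∈ openConnIn (↑(box 3 m) : Set (Site 3)) x y}) :
    ω ∈ {ω : BondConfig (Site 3) | ∃ x ∈ box 3 n, ∃ y ∈ innerBoundary (zdGraph 3) (box 3 m'),
      ω ∈ openConnIn (↑(box 3 m') : Set (Site 3)) x y} := by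
  rcases hm'm.lt_or_eq with hlt | rfl
  · obtain ⟨x, hx, y, hy, hpath⟩ := h
    exact mem_cross_of_pathIn hω hx (box_mono 3 hnm' hx)
      (DCT16.notMem_box_of_mem_innerBoundary_box hlt hy) (DCT16.pathIn_of_mem_openConnIn hpath)
  · exact h

/-- A site of `∂B(2(m+1))` is not in `B(m)`. [folklore] -/
theorem notMem_box_of_mem_innerBoundary_two_mul {m : ℕ} {y : Site 3}
    (hy : y ∈ innerBoundary (zdGraph 3) (box 3 (2 * (m + 1)))) : y ∉ box 3 m :=
  DCT16.notMem_box_of_mem_innerBoundary_box (by omega) hy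

/-- **Peeling.** For `n ≤ m`, an open path inside `B(2m+2)` from `B(n)` to `∂B(2m+2)` yields a
crossing of `B(m)` from `B(n)` (first exit) AND a crossing of the annulus `B(2m+2) ∖ B(m)` from
`B(m+1)` (after the last visit to `B(m)`): `Cross(n, 2(m+1)) ⊆ Cross(n, m) ∩ Ann(m)` on lattice
configurations. [folklore] -/
theorem mem_cross_inter_ann {ω : BondConfig (Site 3)} (hω : ω ⊆ (zdGraph 3).edgeSet) {n m : ℕ}
    (hnm : n ≤ m)
    (h : ω ∈ {ω : BondConfig (Site 3) | ∃ x ∈ box 3 n,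
      ∃ y ∈ innerBoundary (zdGraph 3) (box 3 (2 * (m + 1))),
        ω ∈ openConnIn (↑(box 3 (2 * (m + 1))) : Set (Site 3)) x y}) :
    ω ∈ {ω : BondConfig (Site 3) | ∃ x ∈ box 3 n, ∃ y ∈ innerBoundary (zdGraph 3) (box 3 m),
        ω ∈ openConnIn (↑(box 3 m) : Set (Site 3)) x y} ∩
      {ω : BondConfig (Site 3) | ∃ x ∈ box 3 (m + 1),
        ∃ y ∈ innerBoundary (zdGraph 3) (box 3 (2 * (m + 1))),
          ω ∈ openConnIn ((↑(box 3 (2 * (m + 1))) : Set (Site 3)) \ ↑(box 3 m)) x y} := by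
  obtain ⟨x, hx, y, hy, hpath⟩ := h
  have hp := DCT16.pathIn_of_mem_openConnIn hpath
  have hym : y ∉ box 3 m := notMem_box_of_mem_innerBoundary_two_mul hy
  have hxm : x ∈ box 3 m := box_mono 3 hnm hx
  refine ⟨mem_cross_of_pathIn hω hx hxm hym hp, ?_⟩
  obtain ⟨a, b, ha, -, hb, hab, hpb⟩ :=
    hp.last_exit (C := (↑(box 3 m) : Set (Site 3))) (Finset.mem_coe.2 hxm)
      (fun h => hym (Finset.mem_coe.1 h))
  refine ⟨b, ?_, y, hy, DCT16.mem_openConnIn_of_pathIn hpb⟩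
  exact DCT16.mem_box_succ_of_adj (Finset.mem_coe.1 ha) (DCT16.adj_of_openGraph_adj hω hab)

/-- `Ann(m)` is contained in the event of `CritAnnulusNonCrossing` at `n' = m+1`
(`{B(m+1) ↔ ∂B(2(m+1)) in B(2(m+1))}`; monotonicity of `{x ↔ y in S}` in `S`). [folklore] -/
theorem ann_subset (m : ℕ) :
    {ω : BondConfig (Site 3) | ∃ x ∈ box 3 (m + 1),
      ∃ y ∈ innerBoundary (zdGraph 3) (box 3 (2 * (m + 1))),
        ω ∈ openConnIn ((↑(box 3 (2 * (m + 1))) : Set (Site 3)) \ ↑(box 3 m)) x y} ⊆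
    {ω : BondConfig (Site 3) | ∃ x ∈ box 3 (m + 1),
      ∃ y ∈ innerBoundary (zdGraph 3) (box 3 (2 * (m + 1))),
        ω ∈ openConnIn (↑(box 3 (2 * (m + 1))) : Set (Site 3)) x y} := by
  rintro ω ⟨x, hx, y, hy, hpath⟩
  refine ⟨x, hx, y, hy, ?_⟩
  exact DCT16.mem_openConnIn_of_pathIn ((DCT16.pathIn_of_mem_openConnIn hpath).mono Set.sdiff_subset)

/-! ## Locality and independence -/

/-- `Cross(n, m)` is determined by the pairs inside `B(m)`. [folklore] -/
theorem determinedBy_cross (n m : ℕ) :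
    DeterminedBy {ω : BondConfig (Site 3) | ∃ x ∈ box 3 n,
      ∃ y ∈ innerBoundary (zdGraph 3) (box 3 m), ω ∈ openConnIn (↑(box 3 m) : Set (Site 3)) x y}
      (↑((box 3 m).sym2) : Set (Sym2 (Site 3))) := by
  have h : {ω : BondConfig (Site 3) | ∃ x ∈ box 3 n, ∃ y ∈ innerBoundary (zdGraph 3) (box 3 m),
      ω ∈ openConnIn (↑(box 3 m) : Set (Site 3)) x y} =
      ⋃ x ∈ box 3 n, ⋃ y ∈ innerBoundary (zdGraph 3) (box 3 m),
        openConnIn (↑(box 3 m) : Set (Site 3)) x y := by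
    ext ω; simp only [Set.mem_setOf_eq, Set.mem_iUnion, exists_prop]
  rw [h]
  exact DeterminedBy.iUnion fun x => DeterminedBy.iUnion fun _ =>
    DeterminedBy.iUnion fun y => DeterminedBy.iUnion fun _ =>
      DCT16.determinedBy_openConnIn _ x y (by rw [Finset.coe_sym2])

/-- `Ann(m)` is determined by the pairs inside the annulus `B(2(m+1)) ∖ B(m)`. [folklore] -/
theorem determinedBy_ann (m : ℕ) :
    DeterminedBy {ω : BondConfig (Site 3) | ∃ x ∈ box 3 (m + 1),
      ∃ y ∈ innerBoundary (zdGraph 3) (box 3 (2 * (m + 1))),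
        ω ∈ openConnIn ((↑(box 3 (2 * (m + 1))) : Set (Site 3)) \ ↑(box 3 m)) x y}
      (↑((box 3 (2 * (m + 1)) \ box 3 m).sym2) : Set (Sym2 (Site 3))) := by
  have h : {ω : BondConfig (Site 3) | ∃ x ∈ box 3 (m + 1),
      ∃ y ∈ innerBoundary (zdGraph 3) (box 3 (2 * (m + 1))),
        ω ∈ openConnIn ((↑(box 3 (2 * (m + 1))) : Set (Site 3)) \ ↑(box 3 m)) x y} =
      ⋃ x ∈ box 3 (m + 1), ⋃ y ∈ innerBoundary (zdGraph 3) (box 3 (2 * (m + 1))),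
        openConnIn ((↑(box 3 (2 * (m + 1))) : Set (Site 3)) \ ↑(box 3 m)) x y := by
    ext ω; simp only [Set.mem_setOf_eq, Set.mem_iUnion, exists_prop]
  rw [h]
  exact DeterminedBy.iUnion fun x => DeterminedBy.iUnion fun _ =>
    DeterminedBy.iUnion fun y => DeterminedBy.iUnion fun _ =>
      DCT16.determinedBy_openConnIn _ x y (by rw [Finset.coe_sym2, Finset.coe_sdiff])

/-- The pair sets `B(m).sym2` and `(B(2(m+1)) ∖ B(m)).sym2` are disjoint. [folklore] -/
theorem disjoint_sym2 (m : ℕ) :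
    Disjoint (box 3 m).sym2 ((box 3 (2 * (m + 1)) \ box 3 m).sym2) := by
  rw [Finset.disjoint_left]
  intro s hs hs'
  rw [Finset.mem_sym2_iff] at hs hs'
  exact (Finset.mem_sdiff.1 (hs' s.out.1 (Sym2.out_fst_mem s))).2 (hs s.out.1 (Sym2.out_fst_mem s))

/-- **One peeling step**: under `CritAnnulusNonCrossing` with constant `c`,
`P_{p_c}(Cross(n, 2(m+1))) ≤ (1 - c) · P_{p_c}(Cross(n, m))` for `n ≤ m`. [folklore] -/
theorem real_cross_step {c : ℝ}
    (hXB : ∀ n : ℕ, 1 ≤ n → (bondPercolation (zdGraph 3) (criticalProbI 3)).real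
      {ω : BondConfig (Site 3) | ∃ x ∈ box 3 n, ∃ y ∈ innerBoundary (zdGraph 3) (box 3 (2 * n)),
        ω ∈ openConnIn (↑(box 3 (2 * n)) : Set (Site 3)) x y} ≤ 1 - c)
    {n m : ℕ} (hnm : n ≤ m) :
    (bondPercolation (zdGraph 3) (criticalProbI 3)).real
        {ω : BondConfig (Site 3) | ∃ x ∈ box 3 n,
          ∃ y ∈ innerBoundary (zdGraph 3) (box 3 (2 * (m + 1))),
            ω ∈ openConnIn (↑(box 3 (2 * (m + 1))) : Set (Site 3)) x y} ≤
      (1 - c) * (bondPercolation (zdGraph 3) (criticalProbI 3)).real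
        {ω : BondConfig (Site 3) | ∃ x ∈ box 3 n, ∃ y ∈ innerBoundary (zdGraph 3) (box 3 m),
          ω ∈ openConnIn (↑(box 3 m) : Set (Site 3)) x y} := by
  set μ := bondPercolation (zdGraph 3) (criticalProbI 3) with hμ
  calc μ.real {ω : BondConfig (Site 3) | ∃ x ∈ box 3 n,
          ∃ y ∈ innerBoundary (zdGraph 3) (box 3 (2 * (m + 1))),
            ω ∈ openConnIn (↑(box 3 (2 * (m + 1))) : Set (Site 3)) x y}
      ≤ μ.real ({ω : BondConfig (Site 3) | ∃ x ∈ box 3 n,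
            ∃ y ∈ innerBoundary (zdGraph 3) (box 3 m),
              ω ∈ openConnIn (↑(box 3 m) : Set (Site 3)) x y} ∩
          {ω : BondConfig (Site 3) | ∃ x ∈ box 3 (m + 1),
            ∃ y ∈ innerBoundary (zdGraph 3) (box 3 (2 * (m + 1))),
              ω ∈ openConnIn ((↑(box 3 (2 * (m + 1))) : Set (Site 3)) \ ↑(box 3 m)) x y}) :=
        DCT16.real_mono_of_forall_subset_edgeSet (zdGraph 3) _ fun ω hω h =>
          mem_cross_inter_ann hω hnm h
    _ = μ.real {ω : BondConfig (Site 3) | ∃ x ∈ box 3 n,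
            ∃ y ∈ innerBoundary (zdGraph 3) (box 3 m),
              ω ∈ openConnIn (↑(box 3 m) : Set (Site 3)) x y} *
          μ.real {ω : BondConfig (Site 3) | ∃ x ∈ box 3 (m + 1),
            ∃ y ∈ innerBoundary (zdGraph 3) (box 3 (2 * (m + 1))),
              ω ∈ openConnIn ((↑(box 3 (2 * (m + 1))) : Set (Site 3)) \ ↑(box 3 m)) x y} :=
        DCT16.real_inter_of_determinedBy_disjoint (zdGraph 3) _ (determinedBy_cross n m)
          (determinedBy_ann m) (disjoint_sym2 m)
    _ ≤ μ.real {ω : BondConfig (Site 3) | ∃ x ∈ box 3 n,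
            ∃ y ∈ innerBoundary (zdGraph 3) (box 3 m),
              ω ∈ openConnIn (↑(box 3 m) : Set (Site 3)) x y} * (1 - c) := by
        refine mul_le_mul_of_nonneg_left ?_ measureReal_nonneg
        exact (measureReal_mono (ann_subset m)).trans (hXB (m + 1) (by omega))
    _ = _ := mul_comm _ _

/-- **Iterated peeling**: `P_{p_c}(Cross(n, m)) ≤ (1-c)^k` whenever `n ≤ m` and
`(n+2)·2^k ≤ m+2`. [folklore] -/
theorem real_cross_le_pow {c : ℝ}
    (hXB : ∀ n : ℕ, 1 ≤ n → (bondPercolation (zdGraph 3) (criticalProbI 3)).real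
      {ω : BondConfig (Site 3) | ∃ x ∈ box 3 n, ∃ y ∈ innerBoundary (zdGraph 3) (box 3 (2 * n)),
        ω ∈ openConnIn (↑(box 3 (2 * n)) : Set (Site 3)) x y} ≤ 1 - c)
    (hc1 : 0 ≤ 1 - c) (n : ℕ) :
    ∀ k m : ℕ, n ≤ m → (n + 2) * 2 ^ k ≤ m + 2 →
      (bondPercolation (zdGraph 3) (criticalProbI 3)).real
        {ω : BondConfig (Site 3) | ∃ x ∈ box 3 n, ∃ y ∈ innerBoundary (zdGraph 3) (box 3 m),
          ω ∈ openConnIn (↑(box 3 m) : Set (Site 3)) x y} ≤ (1 - c) ^ k := by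
  intro k
  induction k with
  | zero => intro m _ _; rw [pow_zero]; exact measureReal_le_one
  | succ k ih =>
    intro m hnm hk
    set N := (n + 2) * 2 ^ k with hN
    have hN1 : n + 2 ≤ N := Nat.le_mul_of_pos_right _ (Nat.two_pow_pos k)
    have hk' : 2 * N ≤ m + 2 := by
      rw [hN]; simpa [pow_succ, mul_comm, mul_assoc, mul_left_comm] using hk
    -- the intermediate scale `m' = ⌊(m-2)/2⌋`
    set m' := (m - 2) / 2 with hm'
    have h1 : 2 * (m' + 1) ≤ m := by omega
    have h2 : n ≤ m' := by omega
    have h3 : N ≤ m' + 2 := by omega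
    have h4 : n ≤ 2 * (m' + 1) := by omega
    calc (bondPercolation (zdGraph 3) (criticalProbI 3)).real
          {ω : BondConfig (Site 3) | ∃ x ∈ box 3 n, ∃ y ∈ innerBoundary (zdGraph 3) (box 3 m),
            ω ∈ openConnIn (↑(box 3 m) : Set (Site 3)) x y}
        ≤ (bondPercolation (zdGraph 3) (criticalProbI 3)).real
          {ω : BondConfig (Site 3) | ∃ x ∈ box 3 n,
            ∃ y ∈ innerBoundary (zdGraph 3) (box 3 (2 * (m' + 1))),
              ω ∈ openConnIn (↑(box 3 (2 * (m' + 1))) : Set (Site 3)) x y} :=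
          DCT16.real_mono_of_forall_subset_edgeSet (zdGraph 3) _ fun ω hω h =>
            mem_cross_anti hω h4 h1 h
      _ ≤ (1 - c) * (bondPercolation (zdGraph 3) (criticalProbI 3)).real
          {ω : BondConfig (Site 3) | ∃ x ∈ box 3 n, ∃ y ∈ innerBoundary (zdGraph 3) (box 3 m'),
            ω ∈ openConnIn (↑(box 3 m') : Set (Site 3)) x y} := real_cross_step hXB h2
      _ ≤ (1 - c) * (1 - c) ^ k := mul_le_mul_of_nonneg_left (ih m' h2 h3) hc1
      _ = (1 - c) ^ (k + 1) := by ring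

/-! ## The exponent: from `(1-c)^k` to `C (n/m)^a` -/

/-- Real-analysis step: for `0 < ρ < 1`, `a = -log₂ ρ`, naturals `1 ≤ n ≤ m` and `k` with
`m + 2 < (n+2)·2^(k+1)`, one has `ρ^k ≤ 6^a (n/m)^a` (because `ρ^k = (2^k)^{-a}` and
`2^k > (m+2)/(2(n+2)) ≥ m/(6n)`). [folklore] -/
theorem pow_le_rpow_div {ρ : ℝ} (hρ0 : 0 < ρ) (hρ1 : ρ < 1) {n m k : ℕ} (hn : 1 ≤ n) (hnm : n ≤ m)
    (hk : m + 2 < (n + 2) * 2 ^ (k + 1)) :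
    ρ ^ k ≤ (6 : ℝ) ^ (-Real.logb 2 ρ) * ((n : ℝ) / m) ^ (-Real.logb 2 ρ) := by
  set a := -Real.logb 2 ρ with ha
  have ha0 : 0 < a := neg_pos.2 (Real.logb_neg one_lt_two hρ0 hρ1)
  have hρ : ρ = (2 : ℝ) ^ (-a) := by
    rw [ha, neg_neg, Real.rpow_logb two_pos (by norm_num) hρ0]
  have h1 : ρ ^ k = ((2 : ℝ) ^ (k : ℝ)) ^ (-a) := by
    rw [hρ, ← Real.rpow_natCast, ← Real.rpow_mul (by norm_num : (0 : ℝ) ≤ 2), mul_comm,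
      Real.rpow_mul (by norm_num : (0 : ℝ) ≤ 2)]
  have hn' : (1 : ℝ) ≤ n := by exact_mod_cast hn
  have hnm' : (n : ℝ) ≤ m := by exact_mod_cast hnm
  have hm0 : (0 : ℝ) < m := by linarith
  have hk' : (m : ℝ) + 2 < ((n : ℝ) + 2) * (2 * 2 ^ k) := by
    have := hk
    rw [pow_succ, mul_comm (2 ^ k) 2] at this
    exact_mod_cast this
  have hY : ((m : ℝ) + 2) / (2 * ((n : ℝ) + 2)) ≤ (2 : ℝ) ^ (k : ℝ) := by
    rw [Real.rpow_natCast, div_le_iff₀ (by positivity)]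
    nlinarith [hk']
  have hYpos : 0 < ((m : ℝ) + 2) / (2 * ((n : ℝ) + 2)) := by positivity
  calc ρ ^ k = ((2 : ℝ) ^ (k : ℝ)) ^ (-a) := h1
    _ ≤ (((m : ℝ) + 2) / (2 * ((n : ℝ) + 2))) ^ (-a) :=
        Real.rpow_le_rpow_of_nonpos hYpos hY (neg_nonpos.2 ha0.le)
    _ = ((2 * ((n : ℝ) + 2)) / ((m : ℝ) + 2)) ^ a := by
        rw [Real.rpow_neg hYpos.le, ← Real.inv_rpow hYpos.le, inv_div]
    _ ≤ (6 * ((n : ℝ) / m)) ^ a := by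
        refine Real.rpow_le_rpow (by positivity) ?_ ha0.le
        rw [mul_div_assoc', div_le_div_iff₀ (by positivity) hm0]
        nlinarith
    _ = (6 : ℝ) ^ a * ((n : ℝ) / m) ^ a := Real.mul_rpow (by norm_num) (by positivity)

/-! ## The three implications -/

/-- **`CritAnnulusNonCrossing → CritCrossingPolyDecay`** (items stmt-CriticalPhenomena-0846 → 0849 of
route `PercAnnulusCrossing`): the scale-uniform annulus non-crossing bound `≤ 1 - c` at `p_c(ℤ³)`
gives the polynomial decay `P_{p_c}(B(n) ↔ ∂B(m) in B(m)) ≤ 6^a (n/m)^a`,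
`a = -log₂(1 - min(c, 1/2)) > 0`, by dyadic peeling (`real_cross_le_pow`) with
`k = ⌊log₂((m+2)/(n+2))⌋`. (Newman–Tassion–Wu 2017, Cor. 3.2(3) on slabs; Grimmett 1999 §11.7 in
`d = 2`.) [folklore] -/
theorem critCrossingPolyDecay_of_critAnnulusNonCrossing
    (h : PercAnnulusCrossing.CritAnnulusNonCrossing) :
    PercAnnulusCrossing.CritCrossingPolyDecay := by
  obtain ⟨c, hc, hXB⟩ := h
  -- shrink the constant so that `ρ = 1 - c' ∈ [1/2, 1)`
  set c' := min c (1 / 2) with hc'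
  have hc'0 : 0 < c' := lt_min hc (by norm_num)
  have hc'le : c' ≤ 1 / 2 := min_le_right _ _
  have hc'c : c' ≤ c := min_le_left _ _
  have hρ0 : 0 < 1 - c' := by linarith
  have hρ1 : 1 - c' < 1 := by linarith
  have hXB' : ∀ n : ℕ, 1 ≤ n → (bondPercolation (zdGraph 3) (criticalProbI 3)).real
      {ω : BondConfig (Site 3) | ∃ x ∈ box 3 n, ∃ y ∈ innerBoundary (zdGraph 3) (box 3 (2 * n)),
        ω ∈ openConnIn (↑(box 3 (2 * n)) : Set (Site 3)) x y} ≤ 1 - c' :=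
    fun n hn => (hXB n hn).trans (by linarith)
  refine ⟨-Real.logb 2 (1 - c'), (6 : ℝ) ^ (-Real.logb 2 (1 - c')),
    neg_pos.2 (Real.logb_neg one_lt_two hρ0 hρ1), fun n m hn hnm => ?_⟩
  -- the number of peeling steps
  set q := (m + 2) / (n + 2) with hq
  have hq0 : q ≠ 0 := by
    rw [hq]; exact Nat.ne_of_gt ((Nat.one_le_div_iff (by omega)).2 (by omega))
  have hk1 : (n + 2) * 2 ^ Nat.log 2 q ≤ m + 2 :=
    calc (n + 2) * 2 ^ Nat.log 2 q ≤ (n + 2) * q :=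
          Nat.mul_le_mul_left _ (Nat.pow_log_le_self 2 hq0)
      _ ≤ m + 2 := Nat.mul_div_le (m + 2) (n + 2)
  have hk2 : m + 2 < (n + 2) * 2 ^ (Nat.log 2 q + 1) := by
    have h3 : q < 2 ^ (Nat.log 2 q + 1) := Nat.lt_pow_succ_log_self one_lt_two q
    rw [hq, Nat.div_lt_iff_lt_mul (by omega)] at h3
    rwa [mul_comm]
  exact (real_cross_le_pow hXB' hρ0.le n _ m hnm hk1).trans (pow_le_rpow_div hρ0 hρ1 hn hnm hk2)

/-- `arm_H(0, s+1) ⊆ Cross(1, s)` on lattice configurations: the half-space arm to sup-distance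
`s+1` leaves `Λ_s`, so `0 ∈ B(1)` is joined inside `Λ_s` to `∂Λ_s`
(`Negative.mem_siteToBoundary_of_mem_armH`). [folklore] -/
theorem mem_cross_of_mem_armH {ω : BondConfig (Site 3)} (hω : ω ⊆ (zdGraph 3).edgeSet) {s : ℕ}
    (hA : ω ∈ QuantitativeBGN.Negative.armH (s + 1)) :
    ω ∈ {ω : BondConfig (Site 3) | ∃ x ∈ box 3 1, ∃ y ∈ innerBoundary (zdGraph 3) (box 3 s),
      ω ∈ openConnIn (↑(box 3 s) : Set (Site 3)) x y} := by
  obtain ⟨y, hy, hpath⟩ := QuantitativeBGN.Negative.mem_siteToBoundary_of_mem_armH hω hA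
  exact ⟨0, zero_mem_box 3 1, y, hy, hpath⟩

/-- **`CritCrossingPolyDecay → QuantitativeBGN`** (item stmt-CriticalPhenomena-0849 of
`PercAnnulusCrossing` implies the crux stmt-CriticalPhenomena-0913):
`P_{p_c}(arm_H(0,r)) ≤ P_{p_c}(Cross(1, r-1)) ≤ C (1/(r-1))^a ≤ max(C 2^a, 1) r^{-a}` for `r ≥ 2`,
and trivially for `r = 1`. [folklore] -/
theorem quantitativeBGN_of_critCrossingPolyDecay :
    Summit.CriticalPhenomena.PercolationContinuityZ3.Theses.PercAnnulusCrossing.CritCrossingPolyDecay →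
      Summit.CriticalPhenomena.PercolationContinuityZ3.Theses.PercLowPointHalfSpace.QuantitativeBGN := by
  rintro ⟨a, C, ha, hdec⟩
  have hC : 0 ≤ C := by
    have h11 := hdec 1 1 le_rfl le_rfl
    rw [Nat.cast_one, div_one, Real.one_rpow, mul_one] at h11
    exact measureReal_nonneg.trans h11
  refine QuantitativeBGN.Negative.quantitativeBGN_iff.2 ⟨a, max (C * 2 ^ a) 1, ha, fun r hr => ?_⟩
  have hr0 : (0 : ℝ) < r := by exact_mod_cast hr
  rcases eq_or_lt_of_le hr with hr1 | hr2
  · -- `r = 1`: the bound is `≥ 1`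
    rw [← hr1, Nat.cast_one, Real.one_rpow, mul_one]
    exact measureReal_le_one.trans (le_max_right _ _)
  · obtain ⟨s, rfl⟩ : ∃ s, r = s + 1 := ⟨r - 1, by omega⟩
    have hs : 1 ≤ s := by omega
    have hs0 : (0 : ℝ) < s := by exact_mod_cast hs
    have hdiv : (1 : ℝ) / s ≤ 2 / ((s + 1 : ℕ) : ℝ) := by
      rw [div_le_div_iff₀ hs0 hr0]
      push_cast
      have : (1 : ℝ) ≤ s := by exact_mod_cast hs
      linarith
    calc (bondPercolation (zdGraph 3) (criticalProbI 3)).real (QuantitativeBGN.Negative.armH (s + 1))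
        ≤ (bondPercolation (zdGraph 3) (criticalProbI 3)).real
          {ω : BondConfig (Site 3) | ∃ x ∈ box 3 1, ∃ y ∈ innerBoundary (zdGraph 3) (box 3 s),
            ω ∈ openConnIn (↑(box 3 s) : Set (Site 3)) x y} :=
          DCT16.real_mono_of_forall_subset_edgeSet (zdGraph 3) _ fun ω hω hA =>
            mem_cross_of_mem_armH hω hA
      _ ≤ C * (((1 : ℕ) : ℝ) / s) ^ a := hdec 1 s le_rfl hs
      _ ≤ C * ((2 : ℝ) / ((s + 1 : ℕ) : ℝ)) ^ a := by
          rw [Nat.cast_one]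
          exact mul_le_mul_of_nonneg_left (Real.rpow_le_rpow (by positivity) hdiv ha.le) hC
      _ = C * 2 ^ a * ((s + 1 : ℕ) : ℝ) ^ (-a) := by
          rw [Real.div_rpow (by norm_num) hr0.le, Real.rpow_neg hr0.le, div_eq_mul_inv, mul_assoc]
      _ ≤ max (C * 2 ^ a) 1 * ((s + 1 : ℕ) : ℝ) ^ (-a) :=
          mul_le_mul_of_nonneg_right (le_max_left _ _) (Real.rpow_nonneg hr0.le _)

end OfAnnulusCrossing

end Summit.CriticalPhenomena.PercolationContinuityZ3.Theorems

end
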